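import Mathlib
import Summits.Ventures.HodgeRepro2.HeckeCommensurable
import Summits.Ventures.HodgeRepro2.HolomorphicPeterssonSpace

/-!
# HeckeFiniteIndex — Hecke operators on the Petersson space of ANY finite-index subgroup of `Γ_1`

Blind cell `pub-hodge-repro2`, seat p2 (Tier 5 kernel support, Hecke side).

`HeckeCommensurable.lean` (row 117) proved `[S : S_δ] < ∞` for congruence subgroups
`Γ_{N'} ≤ S ≤ Γ_1` and `δ ∈ U(H)(K)`. The subgroups produced by the Tier-3 input
(`NonVanishingInput`: a subgroup `Γ` of FINITE INDEX in `Γ_1`, and `S' = Γ ⊓ Γ_N`) are only known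
to be of finite index in `Γ_1`. This file removes the congruence hypothesis:

* `finiteIndex_heckeSubgroup_of_finiteIndex`: `[S : S_δ] < ∞` for every finite-index `S ≤ Γ_1`
  (commensurability passes to finite-index subgroups — Mathlib's `relIndex` calculus: `S_δ = S ⊓ δ⁻¹Sδ`,
  `(δ⁻¹Sδ).relIndex (δ⁻¹Γ_1δ) ≠ 0` by `relIndex_comap_ne_zero`, `(δ⁻¹Γ_1δ).relIndex Γ_1 ≠ 0` by row 117
  at `S = Γ_1`, then `relIndex_ne_zero_trans` and `relIndex_eq_zero_of_le_right`);
* `heckeFamilyOf`: the Hecke operators on the Petersson space for ANY family of finiteness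
  instances (the congruence `heckeFamily` of `PeterssonSpace.lean` is the instance
  `fintypeHeckeQuotient`; the finite-index case is `fintypeHeckeQuotientOfFiniteIndex`), with the
  formal-adjoint, holomorphic-stability and joint-eigenbasis statements transported.
-/

namespace Summit.Ventures.HodgeRepro2.ShimuraData

open JointEigenbasis SeparationQuotientOperators

variable {K : Type*} [Field K] [NumberField K] [NumberField.IsCMField K] {τ₁ : K →+* ℂ}
  {H : Matrix (Fin 3) (Fin 3) K} {Q : Matrix (Fin 3) (Fin 3) ℂ}

/-- **Commensurability for finite-index subgroups of `Γ_1`**: `[S : S_δ] < ∞` for every subgroup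
`S` of finite index in `Γ_1 = shimuraLevelSubgroup K H 𝔪 1` and every `δ ∈ U(H)(K)`. -/
theorem finiteIndex_heckeSubgroup_of_finiteIndex {𝔪 : Submodule ℤ (Fin 3 → K)} (h𝔪 : IsLattice K 𝔪)
    {S : Subgroup (GL (Fin 3) K)} (hS : S ≤ shimuraLevelSubgroup K H 𝔪 1)
    (hfin : (S.subgroupOf (shimuraLevelSubgroup K H 𝔪 1)).FiniteIndex) {δ : GL (Fin 3) K}
    (hδ : δ ∈ unitaryGroup K H) : ((heckeSubgroup S δ).subgroupOf S).FiniteIndex := by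
  set Γ := shimuraLevelSubgroup K H 𝔪 1 with hΓ
  set c := (MulAut.conj δ).toMonoidHom with hc
  have h1 : ((heckeSubgroup Γ δ).subgroupOf Γ).FiniteIndex :=
    finiteIndex_heckeSubgroup h𝔪 le_rfl one_ne_zero le_rfl hδ
  have h1' : (Subgroup.comap c Γ).relIndex Γ ≠ 0 := by
    have := Subgroup.finiteIndex_iff.mp h1
    rw [← Subgroup.inf_relIndex_left Γ (Subgroup.comap c Γ)]
    exact this
  have h2 : (Subgroup.comap c S).relIndex (Subgroup.comap c Γ) ≠ 0 :=
    Subgroup.relIndex_comap_ne_zero c (Subgroup.finiteIndex_iff.mp hfin)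
  have h3 : (Subgroup.comap c S).relIndex Γ ≠ 0 := Subgroup.relIndex_ne_zero_trans h2 h1'
  have h4 : (Subgroup.comap c S).relIndex S ≠ 0 :=
    fun h => h3 (Subgroup.relIndex_eq_zero_of_le_right hS h)
  rw [Subgroup.finiteIndex_iff]
  change (S ⊓ Subgroup.comap c S).relIndex S ≠ 0
  rw [Subgroup.inf_relIndex_left]
  exact h4

/-- The finiteness of `S/S_δ` for a finite-index `S ≤ Γ_1`, as a `Fintype` instance. -/
@[reducible]
noncomputable def fintypeHeckeQuotientOfFiniteIndex {𝔪 : Submodule ℤ (Fin 3 → K)}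
    (h𝔪 : IsLattice K 𝔪) {S : Subgroup (GL (Fin 3) K)} (hS : S ≤ shimuraLevelSubgroup K H 𝔪 1)
    (hfin : (S.subgroupOf (shimuraLevelSubgroup K H 𝔪 1)).FiniteIndex) {δ : GL (Fin 3) K}
    (hδ : δ ∈ unitaryGroup K H) : Fintype (S ⧸ (heckeSubgroup S δ).subgroupOf S) :=
  haveI := finiteIndex_heckeSubgroup_of_finiteIndex h𝔪 hS hfin hδ
  Fintype.ofFinite _

variable (hQ : IsFrame K τ₁ H Q) (S : Subgroup (GL (Fin 3) K))
  (hS : (S : Set (GL (Fin 3) K)) ⊆ unitaryGroup K H) [CompactSpace (ballQuotient hQ S hS)]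
  {D : Set ball₂} (k : ℕ) (hD : IsBallFundamentalDomain hQ S hS D) (hDm : MeasurableSet D)

/-- The Hecke operators on the Petersson space for an arbitrary family `inst` of finiteness
instances `Fintype (S / S_δ)`, `δ ∈ U(H)(K)`. -/
noncomputable def heckeFamilyOf
    (inst : ∀ δ : unitaryGroup K H, Fintype (S ⧸ (heckeSubgroup S (δ : GL (Fin 3) K)).subgroupOf S))
    (δ : unitaryGroup K H) : PeterssonSpace hQ S hS k hD →ₗ[ℂ] PeterssonSpace hQ S hS k hD :=
  letI := inst δ
  letI := inst δ⁻¹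
  heckeSpace hQ S hS k hD δ.2 hDm

/-- `(T_δ, T_{δ⁻¹})` is a formal adjoint pair on the Petersson space. -/
theorem isFormalAdjointPair_heckeFamilyOf
    (inst : ∀ δ : unitaryGroup K H, Fintype (S ⧸ (heckeSubgroup S (δ : GL (Fin 3) K)).subgroupOf S))
    (δ : unitaryGroup K H) :
    IsFormalAdjointPair (heckeFamilyOf hQ S hS k hD hDm inst δ)
      (heckeFamilyOf hQ S hS k hD hDm inst δ⁻¹) := by
  letI := inst δ
  letI := inst δ⁻¹
  letI := inst δ⁻¹⁻¹
  exact isFormalAdjointPair_descendSQ _ _ (inner_heckeForms_adjoint hQ S hS k hD δ.2 hDm)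
    (norm_heckeForms_eq_zero hQ S hS k hD δ.2 hDm)
    (norm_heckeForms_eq_zero hQ S hS k hD (inv_mem δ.2) hDm)

/-- Every `T_δ` preserves the holomorphic part of the Petersson space. -/
theorem heckeFamilyOf_mem_holomorphicSpace
    (inst : ∀ δ : unitaryGroup K H, Fintype (S ⧸ (heckeSubgroup S (δ : GL (Fin 3) K)).subgroupOf S))
    (δ : unitaryGroup K H) : ∀ v ∈ holomorphicSpace hQ S hS k hD,
      heckeFamilyOf hQ S hS k hD hDm inst δ v ∈ holomorphicSpace hQ S hS k hD := by
  intro v hv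
  letI := inst δ
  letI := inst δ⁻¹
  exact heckeSpace_mem_holomorphicSpace hQ S hS k hD δ.2 hDm hv

/-- **Simultaneous Hecke eigenforms** for an arbitrary family of finiteness instances: on a
finite-dimensional `T`-stable subspace `V` of the Petersson space, for a family of rational
unitary matrices closed under inversion whose Hecke operators commute pairwise. -/
theorem exists_orthonormalBasis_heckeSpaceOf
    (inst : ∀ δ : unitaryGroup K H, Fintype (S ⧸ (heckeSubgroup S (δ : GL (Fin 3) K)).subgroupOf S))
    {ι : Type*} (δ : ι → unitaryGroup K H) (σ : ι → ι) (hσ : ∀ i, δ (σ i) = (δ i)⁻¹)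
    (hcomm : ∀ i j, Commute (heckeFamilyOf hQ S hS k hD hDm inst (δ i))
      (heckeFamilyOf hQ S hS k hD hDm inst (δ j)))
    (V : Submodule ℂ (PeterssonSpace hQ S hS k hD)) [FiniteDimensional ℂ V]
    (hV : ∀ i, ∀ v ∈ V, heckeFamilyOf hQ S hS k hD hDm inst (δ i) v ∈ V) :
    ∃ b : OrthonormalBasis (Fin (Module.finrank ℂ V)) ℂ V, ∀ a i, ∃ μ : ℂ,
      heckeFamilyOf hQ S hS k hD hDm inst (δ i) (b a) = μ • (b a : PeterssonSpace hQ S hS k hD) := by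
  refine exists_orthonormalBasis_of_isFormalAdjointPair_of_commute_restrict
    (fun i => heckeFamilyOf hQ S hS k hD hDm inst (δ i)) σ (fun i => ?_) hcomm V hV
  rw [hσ i]
  exact isFormalAdjointPair_heckeFamilyOf hQ S hS k hD hDm inst (δ i)

/-- **Simultaneous Hecke eigenforms in the holomorphic forms of a FINITE-INDEX subgroup of
`Γ_1`** (compact quotient, finite-dimensional holomorphic part, commuting inversion-closed Hecke
family): an orthonormal basis of simultaneous Hecke eigenforms. -/
theorem exists_orthonormalBasis_heckeSpace_holomorphic_of_finiteIndex
    {𝔪 : Submodule ℤ (Fin 3 → K)} (h𝔪 : IsLattice K 𝔪) (hS₁ : S ≤ shimuraLevelSubgroup K H 𝔪 1)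
    (hfin : (S.subgroupOf (shimuraLevelSubgroup K H 𝔪 1)).FiniteIndex)
    {ι : Type*} (δ : ι → unitaryGroup K H) (σ : ι → ι) (hσ : ∀ i, δ (σ i) = (δ i)⁻¹)
    (hcomm : ∀ i j, Commute
      (heckeFamilyOf hQ S hS k hD hDm (fun δ => fintypeHeckeQuotientOfFiniteIndex h𝔪 hS₁ hfin δ.2) (δ i))
      (heckeFamilyOf hQ S hS k hD hDm (fun δ => fintypeHeckeQuotientOfFiniteIndex h𝔪 hS₁ hfin δ.2) (δ j)))
    [FiniteDimensional ℂ (holomorphicSpace hQ S hS k hD)] :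
    ∃ b : OrthonormalBasis (Fin (Module.finrank ℂ (holomorphicSpace hQ S hS k hD))) ℂ
        (holomorphicSpace hQ S hS k hD), ∀ a i, ∃ μ : ℂ,
      heckeFamilyOf hQ S hS k hD hDm (fun δ => fintypeHeckeQuotientOfFiniteIndex h𝔪 hS₁ hfin δ.2)
        (δ i) (b a) = μ • (b a : PeterssonSpace hQ S hS k hD) :=
  exists_orthonormalBasis_heckeSpaceOf hQ S hS k hD hDm _ δ σ hσ hcomm _
    (fun i => heckeFamilyOf_mem_holomorphicSpace hQ S hS k hD hDm _ (δ i))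

end Summit.Ventures.HodgeRepro2.ShimuraData
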